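import Summits.SmoothPoincare4.SmoothPoincare4.Theses.SymplecticOrigami
import Literature.Geometry.Manifold.InverseFunctionTheorem
import Literature.Geometry.Manifold.CylinderSlice

/-!
# `OrigamiFoldExistence` — negative-side support: the disconnected witness `S⁴ ⊔ S⁴`

Honest (non-junk) witness for the load-bearing analysis of the crux
`Summit.SmoothPoincare4.SmoothPoincare4.Theses.SymplecticOrigami.OrigamiFoldExistence`
(stmt-SmoothPoincare4-7844; companion of `Negative.LoadBearing`, whose Lean witness is the empty
manifold): the crux with `M ≃ₕ S⁴` deleted fails at the closed smooth 4-manifold `S⁴ ⊔ S⁴`, so any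
proof must use CONNECTEDNESS of `M` (a consequence of `M ≃ₕ S⁴`), not only nonemptiness.

* `no_compact_open_subset_of_piece` — the structural lemma: in the typed fold data, no piece `V i`
  contains a nonempty compact open subset `B` of `M`.  Reason: on `V i` the blow-down `β i` is smooth
  with bijective differential, hence a local diffeomorphism (inverse function theorem on manifolds,
  `Literature.Geometry.Manifold.isLocalDiffeomorphAt_of_mfderiv`), hence open on `B`; `β i '' B` is then
  clopen and nonempty in the connected closed piece `N i`, so it is all of `N i` — but it lies in
  `β i '' V i = (range b i)ᶜ`, which misses the (nonempty) symplectic surface.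
* `not_crux_without_homotopyEquiv_of_compact_nonempty` — the deleted-hypothesis crux fails even over CLOSED
  NONEMPTY `M`: at `M = S⁴ ⊔ S⁴` the connected fold `Z` lies in one summand;
  the other summand is a compact open connected subset of `V 0 ∪ V 1`, hence of one `V i`: contradiction.
-/

noncomputable section

-- the prescribed namespace `Summit.<P>.<Sub>.…` duplicates `SmoothPoincare4` (P = Sub)
set_option linter.dupNamespace false

open scoped Manifold ContDiff Topology ContinuousMap
open Set Function

namespace Summit.SmoothPoincare4.SmoothPoincare4.Theorems.OrigamiFoldExistence.Negative

/-- **No piece of the fold data contains a nonempty compact open subset of `M`.** If `β` is `C^∞`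
on an open `U ⊇ V` with bijective differential on `V` and `β '' V = Rᶜ` for a nonempty `R` in a
connected Hausdorff `N`, then no nonempty compact open `B ⊆ V` exists: `β '' B` would be open
(inverse function theorem) and closed (compact image), hence all of `N`, yet disjoint from `R`.
[folklore] -/
theorem no_compact_open_subset_of_piece {M : Type*} [TopologicalSpace M] [ChartedSpace (EuclideanSpace ℝ (Fin 4)) M]
    [IsManifold (𝓡 4) ∞ M] {N : Type*} [TopologicalSpace N] [T2Space N] [ConnectedSpace N]
    [ChartedSpace (EuclideanSpace ℝ (Fin 4)) N] [IsManifold (𝓡 4) ∞ N] {V U B : Set M} {β : M → N} {R : Set N}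
    (hUo : IsOpen U) (hVU : V ⊆ U) (hβU : ContMDiffOn (𝓡 4) (𝓡 4) ∞ β U) (himg : β '' V = Rᶜ)
    (hR : R.Nonempty) (hbij : ∀ x ∈ V, Function.Bijective (mfderiv (𝓡 4) (𝓡 4) β x))
    (hBo : IsOpen B) (hBc : IsCompact B) (hBne : B.Nonempty) (hBV : B ⊆ V) : False := by
  -- `β '' B` is open: `β` is a local diffeomorphism at every point of `B`
  have hopen : IsOpen (β '' B) := by
    rw [isOpen_iff_forall_mem_open]
    rintro _ ⟨x, hxB, rfl⟩
    have hxV : x ∈ V := hBV hxB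
    let A : (EuclideanSpace ℝ (Fin 4)) →L[ℝ] (EuclideanSpace ℝ (Fin 4)) := mfderiv (𝓡 4) (𝓡 4) β x
    let L : (EuclideanSpace ℝ (Fin 4)) ≃L[ℝ] (EuclideanSpace ℝ (Fin 4)) :=
      (LinearEquiv.ofBijective (A : (EuclideanSpace ℝ (Fin 4)) →ₗ[ℝ] (EuclideanSpace ℝ (Fin 4))) (hbij x hxV)).toContinuousLinearEquiv
    have hL : mfderiv (𝓡 4) (𝓡 4) β x = (L : (EuclideanSpace ℝ (Fin 4)) →L[ℝ] (EuclideanSpace ℝ (Fin 4))) := by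
      ext v
      rfl
    have hloc : IsLocalDiffeomorphAt (𝓡 4) (𝓡 4) ∞ β x :=
      Literature.Geometry.Manifold.isLocalDiffeomorphAt_of_mfderiv (by simp) hUo (hVU hxV) hβU L hL
    obtain ⟨Φ, hxΦ, heq⟩ := hloc
    refine ⟨Φ '' (Φ.source ∩ B), ?_, ?_, ?_⟩
    · rintro _ ⟨z, ⟨hzΦ, hzB⟩, rfl⟩
      exact ⟨z, hzB, heq hzΦ⟩
    · exact Φ.toOpenPartialHomeomorph.isOpen_image_of_subset_source (Φ.open_source.inter hBo)
        inter_subset_left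
    · exact ⟨x, ⟨hxΦ, hxB⟩, (heq hxΦ).symm⟩
  -- `β '' B` is closed: compact image of a compact set under a continuous map
  have hclosed : IsClosed (β '' B) :=
    (hBc.image_of_continuousOn (hβU.continuousOn.mono (hBV.trans hVU))).isClosed
  have huniv : β '' B = univ := IsClopen.eq_univ ⟨hclosed, hopen⟩ (hBne.image β)
  obtain ⟨r, hr⟩ := hR
  have hrV : r ∈ β '' V := image_mono hBV (huniv ▸ mem_univ r)
  rw [himg] at hrV
  exact hrV hr

/-- **Connectedness of `M` is load-bearing**: the crux `OrigamiFoldExistence` with its hypothesis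
`M ≃ₕ S⁴` deleted fails even among CLOSED NONEMPTY smooth 4-manifolds — at `S⁴ ⊔ S⁴` (Mathlib's
disjoint-union manifold structure on two round spheres). The connected fold `Z = (V 0 ∪ V 1)ᶜ` lies in
one summand; the other summand is a nonempty compact open preconnected subset of `V 0 ∪ V 1`, hence of
a single piece `V i`, which `no_compact_open_subset_of_piece` forbids. (The empty-manifold witness of
`Negative.LoadBearing.not_crux_without_homotopyEquiv` does not reach this compact nonempty form.)
[folklore] -/
theorem not_crux_without_homotopyEquiv_of_compact_nonempty : ¬ (∀ (M : Type) [TopologicalSpace M] [T2Space M] [SecondCountableTopology M] [CompactSpace M] [Nonempty M] [ChartedSpace (EuclideanSpace ℝ (Fin 4)) M] [IsManifold (𝓡 4) ∞ M], ∃ (V : Fin 2 → TopologicalSpace.Opens M) (N : Fin 2 → Type) (_ : ∀ i, TopologicalSpace (N i)) (_ : ∀ i, T2Space (N i)) (_ : ∀ i, SecondCountableTopology (N i)) (_ : ∀ i, CompactSpace (N i)) (_ : ∀ i, ConnectedSpace (N i)) (_ : ∀ i, ChartedSpace (EuclideanSpace ℝ (Fin 4)) (N i)) (_ : ∀ i,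 IsManifold (𝓡 4) ∞ (N i)) (s : ∀ i, Literature.Geometry.Kaehler.MForm (𝓡 4) (N i) ℝ 2) (S : Fin 2 → Type) (_ : ∀ i, TopologicalSpace (S i)) (_ : ∀ i, CompactSpace (S i)) (_ : ∀ i, ConnectedSpace (S i)) (_ : ∀ i, ChartedSpace (EuclideanSpace ℝ (Fin 2)) (S i)) (_ : ∀ i, IsManifold (𝓡 2) ∞ (S i)) (b : ∀ i, S i → N i) (β : ∀ i, M → N i), (Disjoint (V 0) (V 1) ∧ (∀ i, (V i : Set M).Nonempty) ∧ IsConnected ((V 0 : Set M) ∪ (V 1 : Set M))ᶜ ∧ (∃ (Z : Type) (_ : TopologicalSpace Z) (_ : ChartedSpace (EuclideanSpace ℝ (Fin 3)) Z) (_ : IsManifold (𝓡 3) ∞ Z) (z : Z → M), Manifold.IsSmoothEmbedding (𝓡 3) (𝓡 4) ∞ z ∧ Set.range z = ((V 0 : Set M) ∪ (V 1 : Set M))ᶜ)) ∧ (∀ i, Literature.Geometry.Kaehler.IsSmoothForm (s i) ∧ Literature.Geometry.Kaehler.IsClosedForm (s i) ∧ (∀ x (v : TangentSpace (𝓡 4)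 x), v ≠ 0 → ∃ w, s i x ![v, w] ≠ 0) ∧ Manifold.IsSmoothEmbedding (𝓡 2) (𝓡 4) ∞ (b i) ∧ (∀ y (v : TangentSpace (𝓡 2) y), v ≠ 0 → ∃ w : TangentSpace (𝓡 2) y, s i (b i y) ![mfderiv (𝓡 2) (𝓡 4) (b i) y v, mfderiv (𝓡 2) (𝓡 4) (b i) y w] ≠ 0) ∧ (∃ U : Set M, IsOpen U ∧ closure (V i : Set M) ⊆ U ∧ ContMDiffOn (𝓡 4) (𝓡 4) ∞ (β i) U) ∧ Set.InjOn (β i) (V i : Set M) ∧ β i '' (V i : Set M) = (Set.range (b i))ᶜ ∧ (∀ x ∈ (V i : Set M), Function.Bijective (mfderiv (𝓡 4) (𝓡 4) (β i) x)) ∧ β i '' frontier (V i : Set M) ⊆ Set.range (b i) ∧ (∀ x ∈ frontier (V i : Set M), Module.finrank ℝ (LinearMap.ker (mfderiv (𝓡 4) (𝓡 4) (β i) x).toLinearMap) = 1))) := by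
  intro h
  haveI := Literature.Geometry.Manifold.CylinderSlice.preconnectedSpace_sphere_four
  haveI : Nonempty (Metric.sphere (0 : EuclideanSpace ℝ (Fin 5)) 1) :=
    ⟨⟨EuclideanSpace.single 0 (1 : ℝ), by simp⟩⟩
  obtain ⟨V, N, i1, i2, i3, i4, i5, i6, i7, s, S, j1, j2, j3, j4, j5, b, β, ⟨hdisj, -, hconn, -⟩, hB⟩ :=
    h ((Metric.sphere (0 : EuclideanSpace ℝ (Fin 5)) 1) ⊕ (Metric.sphere (0 : EuclideanSpace ℝ (Fin 5)) 1))
  have hdisj' : Disjoint (V 0 : Set ((Metric.sphere (0 : EuclideanSpace ℝ (Fin 5)) 1) ⊕ (Metric.sphere (0 : EuclideanSpace ℝ (Fin 5)) 1))) (V 1 : Set ((Metric.sphere (0 : EuclideanSpace ℝ (Fin 5)) 1) ⊕ (Metric.sphere (0 : EuclideanSpace ℝ (Fin 5)) 1))) := TopologicalSpace.Opens.coe_disjoint.2 hdisj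
  -- no piece contains a nonempty compact open subset of `M`
  have hpiece : ∀ (i) (B : Set ((Metric.sphere (0 : EuclideanSpace ℝ (Fin 5)) 1) ⊕ (Metric.sphere (0 : EuclideanSpace ℝ (Fin 5)) 1))), IsOpen B → IsCompact B → B.Nonempty →
      B ⊆ (V i : Set ((Metric.sphere (0 : EuclideanSpace ℝ (Fin 5)) 1) ⊕ (Metric.sphere (0 : EuclideanSpace ℝ (Fin 5)) 1))) → False := by
    intro i B hBo hBc hBne hBV
    obtain ⟨-, -, -, -, -, ⟨U, hUo, hclU, hβU⟩, -, himg, hbij, -, -⟩ := hB i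
    exact no_compact_open_subset_of_piece hUo (subset_closure.trans hclU) hβU himg
      (range_nonempty_iff_nonempty.2 (j3 i).toNonempty) hbij hBo hBc hBne hBV
  -- hence none contains a nonempty compact open preconnected subset of `V 0 ∪ V 1`
  have key : ∀ B : Set ((Metric.sphere (0 : EuclideanSpace ℝ (Fin 5)) 1) ⊕ (Metric.sphere (0 : EuclideanSpace ℝ (Fin 5)) 1)), IsOpen B → IsCompact B → B.Nonempty → IsPreconnected B →
      B ⊆ (V 0 : Set ((Metric.sphere (0 : EuclideanSpace ℝ (Fin 5)) 1) ⊕ (Metric.sphere (0 : EuclideanSpace ℝ (Fin 5)) 1))) ∪ (V 1 : Set ((Metric.sphere (0 : EuclideanSpace ℝ (Fin 5)) 1) ⊕ (Metric.sphere (0 : EuclideanSpace ℝ (Fin 5)) 1))) → False := by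
    intro B hBo hBc hBne hBp hBsub
    rcases hBp.subset_or_subset (V 0).isOpen (V 1).isOpen hdisj' hBsub with h0 | h1
    · exact hpiece 0 B hBo hBc hBne h0
    · exact hpiece 1 B hBo hBc hBne h1
  -- the connected fold lies in one summand; the other summand is such a `B`
  have hlr := (isCompl_range_inl_range_inr (α := Metric.sphere (0 : EuclideanSpace ℝ (Fin 5)) 1)
    (β := Metric.sphere (0 : EuclideanSpace ℝ (Fin 5)) 1)).disjoint
  have hZsub : ((V 0 : Set ((Metric.sphere (0 : EuclideanSpace ℝ (Fin 5)) 1) ⊕ (Metric.sphere (0 : EuclideanSpace ℝ (Fin 5)) 1))) ∪ (V 1 : Set ((Metric.sphere (0 : EuclideanSpace ℝ (Fin 5)) 1) ⊕ (Metric.sphere (0 : EuclideanSpace ℝ (Fin 5)) 1))))ᶜ ⊆ range Sum.inl ∪ range Sum.inr := by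
    rw [Set.range_inl_union_range_inr]
    exact subset_univ _
  rcases hconn.isPreconnected.subset_or_subset isOpen_range_inl isOpen_range_inr hlr hZsub with
    hl | hr
  · refine key (range Sum.inr) isOpen_range_inr (isCompact_range continuous_inr) (range_nonempty _)
      (isPreconnected_range continuous_inr) fun y hy => ?_
    by_contra hy'
    exact Set.disjoint_left.1 hlr (hl hy') hy
  · refine key (range Sum.inl) isOpen_range_inl (isCompact_range continuous_inl) (range_nonempty _)
      (isPreconnected_range continuous_inl) fun y hy => ?_
    by_contra hy'
    exact Set.disjoint_left.1 hlr hy (hr hy')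

end Summit.SmoothPoincare4.SmoothPoincare4.Theorems.OrigamiFoldExistence.Negative

end
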